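import Summits.Ventures.Crystal3D.Theorems.StickyWulffConstantCoaxialWallLawAzimuthSchedulingFwd
import Summits.Ventures.Crystal3D.Theorems.StickyWulffConstantCoaxialWallLawHalfPlanarKey
import HarnessLib

/-!
# Kernel sub-certificates (E) of the planar-heights kissing row at offset `½` (`decide +kernel`, standard axioms)

HONEST FRAMING. Part of the venture `Summits/Ventures/Crystal3D` (cell `crystal3d-full`), helper
`--supports` the crux `CoaxialWallLaw` (stmt-Ventures-19481, `route-Ventures-StickyWulffConstant`),
REGISTERED line `WallLedgerF`, open stub `stub_coaxialTwoSlabAdhesion`.  RUNG CREDIT ONLY; F-C1 not moved.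

The certificate `azSearchF hpTbl 62832 [5,12,12,12,12] 0 12 = true` of `…CoaxialWallLawBiPlanarRowHalf` (there by
`native_decide`) exceeds the default heartbeats under `decide +kernel` as ONE computation (≈ 5·10⁴ search nodes), but
each depth-2 subtree (prefix `[0, a₁, a₂]` with its forward positions) fits.  This file evaluates the subtrees
`[0,3,2]`, `[0,3,3]`, `[0,3,4]` IN THE KERNEL (`decide +kernel`, standard axioms only); `…HalfPlanarCert` assembles the 25 of them into the
certificate, upgrading the (F-γ) bi-planar rung at offset `½` from computational to kernel grade.
-/

namespace Summit.Ventures.Crystal3D.Theorems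

/-- Kernel sub-certificate for the prefix `[0, 3, 2]` (forward positions `[0, 5235, 9800]`). -/
theorem hp_kcert_32 :
    azSearchFGo hpTbl 62832 [5, 12, 12, 12, 12] 9 [0, 3, 2] [0, 5235, 9800] = true := by
  decide +kernel

/-- Kernel sub-certificate for the prefix `[0, 3, 3]` (forward positions `[0, 5235, 26178]`). -/
theorem hp_kcert_33 :
    azSearchFGo hpTbl 62832 [5, 12, 12, 12, 12] 9 [0, 3, 3] [0, 5235, 26178] = true := by
  decide +kernel

/-- Kernel sub-certificate for the prefix `[0, 3, 4]` (forward positions `[0, 5235, 5235]`). -/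
theorem hp_kcert_34 :
    azSearchFGo hpTbl 62832 [5, 12, 12, 12, 12] 9 [0, 3, 4] [0, 5235, 5235] = true := by
  decide +kernel

end Summit.Ventures.Crystal3D.Theorems
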